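import Literature.ModelTheory.ExponentialFields.OMinimalDefinableChoiceProofs
import Literature.NumberTheory.Transcendental.SemialgebraicMaps
import HarnessLib

/-!
# KontsevichZagierPeriods / DefinableMoves — `CovTransfer`, bookkeeping I: real-semialgebraic
# sets as fibres of rational families, and definable points

Helper file for item stmt-KontsevichZagierPeriods-4093 (`CovTransfer`) of route
`DefinableMoves`. Two folklore facts of the Tarski-transfer bookkeeping:

* `exists_rat_family` — every `ℝ`-semialgebraic subset `G ⊆ ℝ^ι` is a fibre `G = W_{d₀}` of a
  `ℚ`-semialgebraic family `W ⊆ ℝ^ι × ℝ^q` (take the real coefficients of the describing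
  polynomials as new variables);
* `exists_mem_isSemialgebraic_singleton` — a nonempty `ℚ`-semialgebraic subset of `ℝ^q` contains a
  point `d` with `{d}` `ℚ`-semialgebraic (definable choice for parameter-free semialgebraic sets,
  tree `vandenDries1998_ch6_prop_1_2_i_holds`, in dimension `0 + q`).

References: Bochnak–Coste–Roy 1998, §2.1–2.2; van den Dries 1998, Ch. 6 (1.2)(i).
-/

noncomputable section

open Set MvPolynomial

namespace Summit.KontsevichZagierPeriods.DefinableMoves.CovTransferAux

open Literature.ModelTheory.ExponentialFields Literature.NumberTheory.Transcendental

/-- Every real polynomial in variables `ι` is the specialisation, at a real point `d ∈ ℝ^q`, of a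
rational polynomial in the variables `ι ⊕ Fin q` (one new variable per coefficient).
[folklore] -/
theorem exists_mvPolynomial_rat_params {ι : Type} (p : MvPolynomial ι ℝ) :
    ∃ (q : ℕ) (P : MvPolynomial (ι ⊕ Fin q) ℚ) (d : Fin q → ℝ),
      ∀ z : ι → ℝ, aeval z p = aeval (Sum.elim z d) P := by
  induction p using MvPolynomial.induction_on with
  | C a =>
    refine ⟨1, X (Sum.inr 0), fun _ => a, fun z => ?_⟩
    simp
  | add p₁ p₂ h₁ h₂ =>
    obtain ⟨q₁, P₁, d₁, hP₁⟩ := h₁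
    obtain ⟨q₂, P₂, d₂, hP₂⟩ := h₂
    refine ⟨q₁ + q₂, rename (Sum.map id (Fin.castAdd q₂)) P₁ +
      rename (Sum.map id (Fin.natAdd q₁)) P₂, Fin.append d₁ d₂, fun z => ?_⟩
    have e₁ : (Sum.elim z (Fin.append d₁ d₂) ∘ Sum.map id (Fin.castAdd q₂)) = Sum.elim z d₁ := by
      ext (i | k) <;> simp
    have e₂ : (Sum.elim z (Fin.append d₁ d₂) ∘ Sum.map id (Fin.natAdd q₁)) = Sum.elim z d₂ := by
      ext (i | k) <;> simp
    rw [map_add, map_add, aeval_rename, aeval_rename, e₁, e₂, hP₁, hP₂]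
  | mul_X p i h =>
    obtain ⟨q, P, d, hP⟩ := h
    refine ⟨q, P * X (Sum.inl i), d, fun z => ?_⟩
    simp only [map_mul, aeval_X, hP, Sum.elim_inl]

/-- **Real-semialgebraic sets are fibres of rational families.** For every `ℝ`-semialgebraic
`G ⊆ ℝ^ι` there are `q`, a `ℚ`-semialgebraic `W ⊆ ℝ^(ι ⊕ Fin q)` and a real point `d ∈ ℝ^q`
with `G = {z | (z, d) ∈ W}` (induction over the generating Boolean algebra; the generators by
`exists_mvPolynomial_rat_params`). [folklore] -/
theorem exists_rat_family {ι : Type} {G : Set (ι → ℝ)} (hG : IsSemialgebraic ℝ G) :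
    ∃ (q : ℕ) (W : Set (ι ⊕ Fin q → ℝ)) (d : Fin q → ℝ),
      IsSemialgebraic ℚ W ∧ ∀ z : ι → ℝ, z ∈ G ↔ Sum.elim z d ∈ W := by
  induction hG using BooleanSubalgebra.closure_bot_sup_induction with
  | mem s hs =>
    rcases hs with ⟨p, rfl⟩ | ⟨p, rfl⟩
    · obtain ⟨q, P, d, hP⟩ := exists_mvPolynomial_rat_params p
      exact ⟨q, {w | aeval w P = 0}, d, isSemialgebraic_setOf_eval_eq_zero P,
        fun z => by simp [hP]⟩
    · obtain ⟨q, P, d, hP⟩ := exists_mvPolynomial_rat_params p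
      exact ⟨q, {w | 0 < aeval w P}, d, isSemialgebraic_setOf_eval_pos P,
        fun z => by simp [hP]⟩
  | bot => exact ⟨0, ∅, Fin.elim0, isSemialgebraic_empty, fun z => by simp⟩
  | sup s _ t _ hs ht =>
    obtain ⟨q₁, W₁, d₁, hW₁, h₁⟩ := hs
    obtain ⟨q₂, W₂, d₂, hW₂, h₂⟩ := ht
    refine ⟨q₁ + q₂,
      ((fun w => w ∘ Sum.map id (Fin.castAdd q₂)) ⁻¹' W₁) ∪
        ((fun w => w ∘ Sum.map id (Fin.natAdd q₁)) ⁻¹' W₂),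
      Fin.append d₁ d₂, (hW₁.preimage_comp _).union (hW₂.preimage_comp _), fun z => ?_⟩
    have e₁ : (Sum.elim z (Fin.append d₁ d₂) ∘ Sum.map id (Fin.castAdd q₂)) = Sum.elim z d₁ := by
      ext (i | k) <;> simp
    have e₂ : (Sum.elim z (Fin.append d₁ d₂) ∘ Sum.map id (Fin.natAdd q₁)) = Sum.elim z d₂ := by
      ext (i | k) <;> simp
    simp only [mem_preimage, mem_union, e₁, e₂, ← h₁, ← h₂]
    rfl
  | compl s _ hs =>
    obtain ⟨q, W, d, hW, h⟩ := hs
    exact ⟨q, Wᶜ, d, hW.compl, fun z => by simp [h]⟩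

/-- **A nonempty `ℚ`-semialgebraic set has a `ℚ`-definable point**: if `T ⊆ ℝ^q` is
`ℚ`-semialgebraic and nonempty then some `d ∈ T` has `{d}` `ℚ`-semialgebraic (definable choice,
van den Dries 1998 Ch. 6 (1.2)(i), for the parameter-free semialgebraic set `T` seen in
`ℝ^(0+q)`: the choice map `g : ℝ^0 → ℝ^q` has `ℚ`-semialgebraic graph, which is the point
`g(∗)`). [cite: Dries1998, Ch. 6 §1 Proposition (1.2)(i), p. 94] -/
theorem exists_mem_isSemialgebraic_singleton {q : ℕ} {T : Set (Fin q → ℝ)}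
    (hT : IsSemialgebraic ℚ T) (hne : T.Nonempty) :
    ∃ d ∈ T, IsSemialgebraic ℚ ({d} : Set (Fin q → ℝ)) := by
  set V : Set (Fin (0 + q) → ℝ) := (fun w => w ∘ Fin.natAdd 0) ⁻¹' T with hV
  have hVs : IsSemialgebraic ℚ V := hT.preimage_comp _
  obtain ⟨g, hg, hgV⟩ := vandenDries1998_ch6_prop_1_2_i_holds V hVs
  obtain ⟨t, ht⟩ := hne
  have happ : ∀ (x : Fin 0 → ℝ) (y : Fin q → ℝ),
      ((Fin.append x y : Fin (0 + q) → ℝ) ∘ Fin.natAdd 0) = y := by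
    intro x y
    funext j
    exact Fin.append_right x y j
  have hmemV : ∀ (x : Fin 0 → ℝ) (y : Fin q → ℝ), Fin.append x y ∈ V ↔ y ∈ T := by
    intro x y
    simp only [hV, mem_preimage, happ]
  have hd : g Fin.elim0 ∈ T := (hmemV _ _).1 (hgV Fin.elim0 t ((hmemV _ t).2 ht))
  refine ⟨g Fin.elim0, hd, ?_⟩
  have key : ({g Fin.elim0} : Set (Fin q → ℝ)) =
      (fun y : Fin q → ℝ => y ∘ Fin.cast (Nat.zero_add q)) ⁻¹'
        {z : Fin (0 + q) → ℝ | ∃ x ∈ {x : Fin 0 → ℝ | ∃ y, Fin.append x y ∈ V},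
          z = Fin.append x (g x)} := by
    ext y
    simp only [mem_singleton_iff, mem_preimage, mem_setOf_eq]
    constructor
    · rintro rfl
      exact ⟨Fin.elim0, ⟨t, (hmemV _ t).2 ht⟩, (Fin.elim0_append _).symm⟩
    · rintro ⟨x, -, hx⟩
      obtain rfl : x = Fin.elim0 := Subsingleton.elim _ _
      rw [← Fin.elim0_append] at hx
      have h2 := congrArg (fun z : Fin (0 + q) → ℝ => z ∘ Fin.natAdd 0) hx
      simpa only [happ] using h2
  rw [key]
  exact hg.preimage_comp _

end Summit.KontsevichZagierPeriods.DefinableMoves.CovTransferAux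

end
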